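import Summits.ABC.IUTFork.Conditional.AbcOfSGenuineKTameRobust
import Summits.ABC.IUTFork.Cor312LicenceTamePairsGenuineK
import Summits.ABC.IUTFork.Cor312GenuineKLocalType
import Summits.ABC.IUTFork.Cor312PilotIdelesPrCapstone
import HarnessLib

/-!
# Branch C / R-W lane P+: the INHABITED side at GENUINE data — at an all-lattice-tame datum whose bad places have pole order `2`
# the hull-level clause S_H HOLDS (chosen ideles, pinned reading), and so does the typed Statement of [IUTchIII] Cor. 3.12 there

PROOF-ONLY file (no `def`, no new `Prop`, no instance) of the abc-iut cell (WAVE-4 prover seat abc-iut-w4-d107, gen 6; D-0079 R-W «WINDOW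
Θ-SIDE INEQUALITY», row «W:TAME-SHALLOW-INHABITED», lane P+, HOME/STATUS 2026-08-26T19:55Z). TAKES NO SIDE on [IUTchIII] Cor. 3.12
(S. Mochizuki, *Inter-universal Teichmüller theory III*, Cor. 3.12 p. 173–174, Step (xi-f) p. 184) or on any author. NO new engine: abc-iut-w4-d006's
EXACT pair predicate at all-tame genuine `K`-level data (`Cor312Prov.licence_settingPrVolSharp_pilotDataOfK_iff_of_tame_pairs`, p450749 lineage:
`Licence ⟺ ∀ bad p, ∀ j ≤ l⋆, ∀ bad w, y | p: e_y·(e_w·min(D_{j,w}, D_{j,y}) + 1) ≤ e_y·P_w + j·e_w·(e_y − 1)`, `D_{j,x} = (j²·P_x − 1) div e_x`,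
`2l·P_x = e(x|v)·ord_v(q_v)`), read on its INHABITED side.

WHAT IS PROVED.
* §1 `TameShallow.pair_test` — the integer lemma: `1 ≤ j < l`, `P_w, P_y ≥ 1`, **`l·P_w ≤ e_w`, `l·P_y ≤ e_y`** ⇒ the pair inequality HOLDS
  (`e_w·min ≤ e_w·D_{j,w} ≤ j²P_w − 1`, then `e_y(j²−1)P_w ≤ j·e_w·(e_y−1)` from `e_w ≥ l·P_w`, `e_y ≥ l`, `j(l−j) + 1 ≥ j + 1`). The hypothesis
  `l·P_w ≤ e_w` says `ord_w(q) = 2l·P_w ≤ 2·e(w|p)`, i.e. the POLE ORDER of `j_E` under `w` is `≤ 2` (`v_p = 1` for a Frey–Legendre point).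
* §2 GENUINE `K`-datum `X := Cor312Prov.pilotDataOfK D K` ([IUTchI] Def. 3.1 initial Θ-data `D`), CHOSEN realising ideles, every choice of the free
  context binders and Kummer datum: if every place of `K` over a prime below a bad place is lattice-tame (`p > 2`, `e(x|p) ≤ p − 2`) and every bad place
  `w` has `e(w|v)·ord_v(q_v) ≤ 2·e(w|p)`, then **`GenuineK.licence_chosen_of_tame_shallow`** (abc-iut-c312-1's (xi-f) `Licence`),
  **`GenuineK.pilotKummerCompatHull_chosen_of_tame_shallow`** (the hull-level clause `Cor312Vol.PilotKummerCompatHull … (fun _ => qRegion) qK` —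
  VERBATIM the per-datum object of the window binders `hSHw`/`hSHwBad` of p447945 / p450130 / p453137 — HOLDS: an INSTANCE of that binder
  discharged), and **`GenuineK.statement_chosen_of_tame_shallow`** (the typed `Cor312.Setting.Statement` of [IUTchIII] Cor. 3.12 HOLDS at that
  genuine print-normalised sharp setting, by abc-iut-c312-1's `statement_of_licence` with abc-iut-w5-d068's `bridgeHyps_settingPrVolSharp_of_ideles`).
The rational-point / abc-TRIPLE forms and the WORKED ROWS (`1 + 2¹⁶ = 65537` at every `l` with `60·l + 2 ≤ 65537`; `1 + 2²·7³ = 1373` at `l = 7`)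
are the sequel file `AbcOfSGenuineKTameShallowInhabitedRatPoint.lean`.

READING (numbers, not adjectives): the R-W table's INHABITED side at GENUINE data was EMPTY (WINDOW-SPEC v0.5b §2e/§2f: W1 = 0; inhabited theorems
only at synthetic/concrete tame data); these are datum CLASSES where OUR typed S_H — and with it OUR typed Cor. 3.12 Statement at the genuine sharp
setting — HOLD, by (Ind1)-inflation at shallow tame packets, NOT by the disputed inference. They are Szpiro-GOOD, hence OFF the critical path of the
conditional certificates (p450130's double cut); their content is the faithfulness/vacuity question «is the typed clause ever TRUE at genuine
admissible data?», complementing the REFUTED genuine rows (HEX `k ≥ 20`, the robust TE/LIN Frey rows of abc-iut-w5-d107). HONEST SCOPE: SHARP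
reading; OUR containers; the per-label licence is a STRONGER-THAN-PRINT form of (xi-f) — its holding implies nothing about print beyond our typing;
admissibility ((P2)(P5)(P6), core, `U_P`) and NON-EMPTINESS of the datum types are NOT claimed (apex assemblers'/numerics' input, exactly as for
the refuted rows); «inhabited as typed» ≠ «true in print»; typed ≠ proved; instantiated ≠ endorsed; no abc claim. [cite: Mochizuki2012, IUTchIII
Cor. 3.12 p. 173–174, Step (xi-f) p. 184; IUTchI Def. 3.1 (b),(c) p. 61, Ex. 3.2 (iv) p. 71; IUTchIV Prop. 1.1 p. 9, Cor. 2.2 (ii) proof (P5) p. 46]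
[cite: DupuyHilado2025, §3.3, §3.4, §3.9, §4.9] [cite: ScholzeStix2018, §2.2 pp. 9–10] [claim: Mochizuki2012, status: disputed] for every IUT
sentence quoted.
-/

noncomputable section

open Set Function NumberField IsDedekindDomain

/-! ## §1. The integer lemma: pole order `2` at lattice-tame bad places puts EVERY label on the inhabited side -/

namespace Summit.ABC.IUTFork.Conditional.TameShallow

/-- **Inhabited side of the exact tame pair predicate.** For integers `1 ≤ j < l`, `P_w, P_y ≥ 1`, `e_w ≥ l·P_w`, `e_y ≥ l·P_y`:
`e_y·(e_w·min((j²P_w − 1)/e_w, (j²P_y − 1)/e_y) + 1) ≤ e_y·P_w + j·e_w·(e_y − 1)` (integer division). [folklore] -/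
theorem pair_test {l j ew ey Pw Py : ℤ} (hj1 : 1 ≤ j) (hjl : j < l) (hPw : 1 ≤ Pw) (hPy : 1 ≤ Py)
    (hw : l * Pw ≤ ew) (hy : l * Py ≤ ey) :
    ey * (ew * min ((j ^ 2 * Pw - 1) / ew) ((j ^ 2 * Py - 1) / ey) + 1) ≤ ey * Pw + j * ew * (ey - 1) := by
  have hl : 2 ≤ l := by omega
  have hew : 1 ≤ ew := by nlinarith
  have hey : l ≤ ey := by nlinarith
  have hD : ew * ((j ^ 2 * Pw - 1) / ew) ≤ j ^ 2 * Pw - 1 := Int.mul_ediv_self_le (by omega)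
  have hmin : min ((j ^ 2 * Pw - 1) / ew) ((j ^ 2 * Py - 1) / ey) ≤ (j ^ 2 * Pw - 1) / ew := min_le_left _ _
  have h1 : ew * min ((j ^ 2 * Pw - 1) / ew) ((j ^ 2 * Py - 1) / ey) ≤ j ^ 2 * Pw - 1 :=
    (mul_le_mul_of_nonneg_left hmin (by omega)).trans hD
  have h2 : ey * (ew * min ((j ^ 2 * Pw - 1) / ew) ((j ^ 2 * Py - 1) / ey) + 1) ≤ ey * (j ^ 2 * Pw) :=
    mul_le_mul_of_nonneg_left (by linarith) (by omega)
  -- `e_y·(j² − 1) ≤ j·l·(e_y − 1)` from `e_y ≥ l`, `j(l − j) + 1 ≥ j + 1`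
  have h5 : j + 1 ≤ j * l - j ^ 2 + 1 := by nlinarith
  have h6 : l * (j + 1) ≤ ey * (j * l - j ^ 2 + 1) :=
    calc l * (j + 1) ≤ ey * (j + 1) := mul_le_mul_of_nonneg_right hey (by omega)
      _ ≤ ey * (j * l - j ^ 2 + 1) := mul_le_mul_of_nonneg_left h5 (by omega)
  have h4 : ey * (j ^ 2 - 1) ≤ j * l * (ey - 1) := by nlinarith
  -- multiply by `P_w ≥ 0` and use `e_w ≥ l·P_w`
  have h7 : ey * (j ^ 2 - 1) * Pw ≤ j * l * (ey - 1) * Pw := mul_le_mul_of_nonneg_right h4 (by omega)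
  have h8 : j * (l * Pw) * (ey - 1) ≤ j * ew * (ey - 1) :=
    mul_le_mul_of_nonneg_right (mul_le_mul_of_nonneg_left hw (by omega)) (by omega)
  nlinarith

end Summit.ABC.IUTFork.Conditional.TameShallow

/-! ## §2. The GENUINE `K`-datum with the CHOSEN realising ideles: all-tame + pole order `2` ⇒ Licence, S_H, Statement -/

namespace Summit.ABC.IUTFork.Conditional

open Thm311 Thm311.Real Cor312 Cor312Vol Cor312Prov Literature.IUT.LogThetaLattice Literature.IUT.LogVolume
  Literature.IUT.HodgeTheaters Literature.IUT.LogVolume.ThetaData Literature.IUT.LogVolume.Cor22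
open Literature.NumberTheory.NumberFields Literature.NumberTheory.GaloisRepresentations.Ultrametric
open Literature.NumberTheory.DiophantineGeometry.GenEll Summit.ABC.ABC.Theorems

section PerDatum

variable {F K Fbar : Type} [Field F] [NumberField F] [Field K] [NumberField K] [Algebra F K] [Field Fbar]
  [Algebra F Fbar] [Algebra K Fbar] {E : WeierstrassCurve F} [E.IsElliptic] {l : ℕ} {Pb : BadPlacePredicates K}
  (D : InitialThetaData F K Fbar E l Pb)
  (M : Type) [Field M] [NumberField M]
  (archPk : ∀ (j : (thetaIndex (pilotDataOfK D K)).Label) (vQ : (thetaIndex (pilotDataOfK D K)).VQ), Set ((logShellsDH (pilotDataOfK D K) (analyticLogv K)).Packet j vQ))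
  (archSub : ∀ (j : (thetaIndex (pilotDataOfK D K)).Label) (v : (thetaIndex (pilotDataOfK D K)).V),
    Set ((logShellsDH (pilotDataOfK D K) (analyticLogv K)).Packet j ((thetaIndex (pilotDataOfK D K)).over v)))
  (Ψ : ℤ → ∀ v : (thetaIndex (pilotDataOfK D K)).V, v ∈ (thetaIndex (pilotDataOfK D K)).Vbad → Set ((logShellsDH (pilotDataOfK D K) (analyticLogv K)).StarPacket v))
  (act : ℤ → ∀ v : (thetaIndex (pilotDataOfK D K)).V, v ∈ (thetaIndex (pilotDataOfK D K)).Vbad →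
    (logShellsDH (pilotDataOfK D K) (analyticLogv K)).StarPacket v → Module.End ℚ ((logShellsDH (pilotDataOfK D K) (analyticLogv K)).StarPacket v))
  (Mmod : ℤ → ∀ j : (thetaIndex (pilotDataOfK D K)).LabelStar, Set ((logShellsDH (pilotDataOfK D K) (analyticLogv K)).GlobalPacket j.1))
  (region : ℤ → ∀ j : (thetaIndex (pilotDataOfK D K)).LabelStar, FinDivisor M → ∀ vQ : (thetaIndex (pilotDataOfK D K)).VQ,
    Set ((logShellsDH (pilotDataOfK D K) (analyticLogv K)).Packet j.1 vQ))
  (frobAdm : ℤ → ℤ → ∀ (j : (thetaIndex (pilotDataOfK D K)).Label) (vQ : (thetaIndex (pilotDataOfK D K)).VQ),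
    Set ((logShellsDH (pilotDataOfK D K) (analyticLogv K)).Packet j vQ) → Prop)
  (frobLogvol : ℤ → ℤ → ∀ (j : (thetaIndex (pilotDataOfK D K)).Label) (vQ : (thetaIndex (pilotDataOfK D K)).VQ),
    Set ((logShellsDH (pilotDataOfK D K) (analyticLogv K)).Packet j vQ) → ℝ)
  (frobΨ : ℤ → ℤ → ∀ v : (thetaIndex (pilotDataOfK D K)).V, v ∈ (thetaIndex (pilotDataOfK D K)).Vbad → Set ((logShellsDH (pilotDataOfK D K) (analyticLogv K)).StarPacket v))
  (frobMmod : ℤ → ℤ → ∀ j : (thetaIndex (pilotDataOfK D K)).LabelStar, Set ((logShellsDH (pilotDataOfK D K) (analyticLogv K)).GlobalPacket j.1))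
  (unitImage : ℤ → ℤ → ℕ → ∀ (j : (thetaIndex (pilotDataOfK D K)).Label) (vQ : (thetaIndex (pilotDataOfK D K)).VQ),
    Set ((logShellsDH (pilotDataOfK D K) (analyticLogv K)).Packet j vQ))
  (ballImage : ℤ → ℤ → ∀ (j : (thetaIndex (pilotDataOfK D K)).Label) (vQ : (thetaIndex (pilotDataOfK D K)).VQ),
    Set ((logShellsDH (pilotDataOfK D K) (analyticLogv K)).Packet j vQ))
  (thetaDiv : ℤ → ℤ → LgpDivisor M (thetaIndex (pilotDataOfK D K)).lstar)
  (n : ℤ) {HT : Type} {LogLink : HT → HT → Type} {IsFull : ∀ {s t : HT}, LogLink s t → Prop}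
  (lat : LGPGaussianLogThetaLattice LogLink IsFull)
  {Frd : Type} {IsoF : Frd → Frd → Type} {Ob : Frd → Type} {realify : Frd → Frd} {Strip : Type}
  {IsoS : Strip → Strip → Type} {Mv : ∀ v : (thetaIndex (pilotDataOfK D K)).V, v ∈ (thetaIndex (pilotDataOfK D K)).Vbad → Type}
  [∀ v h, Monoid (Mv v h)]
  (sig : GlobalLGPFrobenioidSignature (thetaIndex (pilotDataOfK D K)).lstar (thetaIndex (pilotDataOfK D K)).V (· ∈ (thetaIndex (pilotDataOfK D K)).Vbad)
    Frd IsoF Ob realify Strip IsoS Mv)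
  (split : SplittingMonoids Mv) {ObΔ : Type} {N : ∀ v : (thetaIndex (pilotDataOfK D K)).V, v ∈ (thetaIndex (pilotDataOfK D K)).Vbad → Type}
  [∀ v h, Monoid (N v h)] (qData : QPilotData ObΔ N)
  (qK : ∀ v : (thetaIndex (pilotDataOfK D K)).V, v ∈ (thetaIndex (pilotDataOfK D K)).Vbad → Set ((logShellsDH (pilotDataOfK D K) (analyticLogv K)).StarPacket v))

/-- **INHABITED LICENCE AT THE GENUINE `K`-DATUM (chosen realising ideles).** At `X := pilotDataOfK D K`: if every place `x` of `K` over a prime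
`p` below a bad place is lattice-tame (`p > 2`, `e(x|p) ≤ p − 2`) and every bad place `w | p` has **`e(w|v)·ord_v(q_v) ≤ 2·e(w|p)`** (pole order of
`j_E` under `w` at most `2`; `2l·P_q(w) = e(w|v)·ord_v(q_v)` by abc-iut-w5-d009's `exists_nat_qPilot_pilotDataOfK`, so `l·P_q(w) ≤ e(w|p)`), then
abc-iut-c312-1's (xi-f) `Licence` HOLDS at abc-iut-c312-7's `settingPrVolSharp` — abc-iut-w4-d006's pair predicate holds at every label by §1.
[cite: Mochizuki2012, IUTchI Ex. 3.2 (iv) p. 71; IUTchIII Cor. 3.12 Step (xi-f) p. 184] [cite: DupuyHilado2025, §3.3, §3.4, §4.9]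
[claim: Mochizuki2012, status: disputed] -/
theorem GenuineK.licence_chosen_of_tame_shallow
    (htame : ∀ (pp : Nat.Primes) (x : (thetaIndex (pilotDataOfK D K)).Fibre (.inr pp)),
      haveI : Fact (pp : ℕ).Prime := ⟨pp.2⟩
      (∃ w : (thetaIndex (pilotDataOfK D K)).Fibre (.inr pp), placeOf (pilotDataOfK D K) pp.1 w ∈ (pilotDataOfK D K).S) →
        2 < (pp : ℕ) ∧ (placeOf (pilotDataOfK D K) pp.1 x).asIdeal.ramificationIdx ℤ ≤ (pp : ℕ) - 2)
    (hshallow : ∀ (pp : Nat.Primes) (w : (thetaIndex (pilotDataOfK D K)).Fibre (.inr pp)),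
      haveI : Fact (pp : ℕ).Prime := ⟨pp.2⟩
      placeOf (pilotDataOfK D K) pp.1 w ∈ (pilotDataOfK D K).S →
        (finBelow F K (placeOf (pilotDataOfK D K) pp.1 w)).asIdeal.ramificationIdx' (placeOf (pilotDataOfK D K) pp.1 w).asIdeal *
            qParamOrd E (finBelow F K (placeOf (pilotDataOfK D K) pp.1 w)) ≤
          2 * (placeOf (pilotDataOfK D K) pp.1 w).asIdeal.ramificationIdx ℤ) :
    Thm311ToCor312.Licence
      (settingPrVolSharp (pilotDataOfK D K) (logvAnalytic_analyticLogv (F := K)) M archPk archSub Ψ act Mmod region n lat sig split qData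
        (exists_realising_qIdeles_pilotDataOfK D).choose (exists_realising_thetaIdeles_pilotDataOfK D).choose
        (exists_realising_qIdeles_pilotDataOfK D).choose_spec.1 (exists_realising_qIdeles_pilotDataOfK D).choose_spec.2.1) := by
  classical
  refine (licence_settingPrVolSharp_pilotDataOfK_iff_of_tame_pairs D (logvAnalytic_analyticLogv (F := K)) M archPk archSub Ψ act Mmod region
    n lat sig split qData (exists_realising_qIdeles_pilotDataOfK D).choose (exists_realising_thetaIdeles_pilotDataOfK D).choose
    (exists_realising_qIdeles_pilotDataOfK D).choose_spec.1 (exists_realising_qIdeles_pilotDataOfK D).choose_spec.2.1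
    (exists_realising_thetaIdeles_pilotDataOfK D).choose_spec.1 (exists_realising_thetaIdeles_pilotDataOfK D).choose_spec.2.2
    (exists_realising_qIdeles_pilotDataOfK D).choose_spec.2.2 htame).mpr ?_
  intro pp i w y hw hy Pw Py hPw hPy
  haveI : Fact (pp : ℕ).Prime := ⟨pp.2⟩
  obtain ⟨Pw', hPw', hPw1, hPweq⟩ := exists_nat_qPilot_pilotDataOfK D hw
  obtain ⟨Py', hPy', hPy1, hPyeq⟩ := exists_nat_qPilot_pilotDataOfK D hy
  have hww : Pw' = Pw := by have := hPw'.symm.trans hPw; exact_mod_cast this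
  have hyy : Py' = Py := by have := hPy'.symm.trans hPy; exact_mod_cast this
  subst hww
  subst hyy
  have h5 : 5 ≤ l := D.five_le_l
  have hlw : l * Pw' ≤ (placeOf (pilotDataOfK D K) pp.1 w).asIdeal.ramificationIdx ℤ := by
    have h2 : 2 * (l * Pw') ≤ 2 * (placeOf (pilotDataOfK D K) pp.1 w).asIdeal.ramificationIdx ℤ := by
      rw [← mul_assoc, hPweq]
      exact hshallow pp w hw
    omega
  have hly : l * Py' ≤ (placeOf (pilotDataOfK D K) pp.1 y).asIdeal.ramificationIdx ℤ := by
    have h2 : 2 * (l * Py') ≤ 2 * (placeOf (pilotDataOfK D K) pp.1 y).asIdeal.ramificationIdx ℤ := by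
      rw [← mul_assoc, hPyeq]
      exact hshallow pp y hy
    omega
  -- the label `j = i + 1 < l`
  have hlstar : (pilotDataOfK D K).lstar = (l - 1) / 2 := by
    show ((pilotDataOfK D K).l - 1) / 2 = (l - 1) / 2
    rw [pilotDataOfK_l]
  have hi : (i : ℕ) < (l - 1) / 2 := by rw [← hlstar]; exact i.2
  have hjl : (((i : ℕ) + 1 : ℕ) : ℤ) < (l : ℤ) := by push_cast; omega
  exact TameShallow.pair_test (l := (l : ℤ)) (by push_cast; omega) hjl (by exact_mod_cast hPw1) (by exact_mod_cast hPy1)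
    (by exact_mod_cast hlw) (by exact_mod_cast hly)

/-- **INHABITED S_H AT THE GENUINE `K`-DATUM — an INSTANCE of the window binder's per-datum object.** Same hypotheses; conclusion: the
hull-level clause `Cor312Vol.PilotKummerCompatHull … (fun _ => qRegion) qK` at the genuine sharp setting over `K` with the CHOSEN realising
ideles and the PINNED reading — verbatim the per-datum object of `hSHw` / `hSHwBad` (p447945 / p450130 / p453137) — HOLDS, for EVERY choice of
the free context binders and Kummer datum (the inclusion at the junk label `0` is the mover argument of abc-iut-w5-d009's
`exists_qPinned_and_hull_settingPrVolSharp_iff_licence`, the chosen q-ideles having norm `≤ 1`). «inhabited as typed» ≠ «true in print».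
[cite: Mochizuki2012, IUTchIII Cor. 3.12 Step (xi-f) p. 184] [cite: DupuyHilado2025, §3.4, §4.9] [claim: Mochizuki2012, status: disputed] -/
theorem GenuineK.pilotKummerCompatHull_chosen_of_tame_shallow
    (htame : ∀ (pp : Nat.Primes) (x : (thetaIndex (pilotDataOfK D K)).Fibre (.inr pp)),
      haveI : Fact (pp : ℕ).Prime := ⟨pp.2⟩
      (∃ w : (thetaIndex (pilotDataOfK D K)).Fibre (.inr pp), placeOf (pilotDataOfK D K) pp.1 w ∈ (pilotDataOfK D K).S) →
        2 < (pp : ℕ) ∧ (placeOf (pilotDataOfK D K) pp.1 x).asIdeal.ramificationIdx ℤ ≤ (pp : ℕ) - 2)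
    (hshallow : ∀ (pp : Nat.Primes) (w : (thetaIndex (pilotDataOfK D K)).Fibre (.inr pp)),
      haveI : Fact (pp : ℕ).Prime := ⟨pp.2⟩
      placeOf (pilotDataOfK D K) pp.1 w ∈ (pilotDataOfK D K).S →
        (finBelow F K (placeOf (pilotDataOfK D K) pp.1 w)).asIdeal.ramificationIdx' (placeOf (pilotDataOfK D K) pp.1 w).asIdeal *
            qParamOrd E (finBelow F K (placeOf (pilotDataOfK D K) pp.1 w)) ≤
          2 * (placeOf (pilotDataOfK D K) pp.1 w).asIdeal.ramificationIdx ℤ) :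
    Cor312Vol.PilotKummerCompatHull
        (LatticeSituation.ofShells (logShellsDH (pilotDataOfK D K) (analyticLogv K)) M archPk archSub
        (summandPiecesPr (pilotDataOfK D K) (logvAnalytic_analyticLogv (F := K))).Adm
        (summandPiecesPr (pilotDataOfK D K) (logvAnalytic_analyticLogv (F := K))).logvol Ψ act Mmod region frobAdm frobLogvol frobΨ
        frobMmod unitImage ballImage thetaDiv)
        (settingPrVolSharp (pilotDataOfK D K) (logvAnalytic_analyticLogv (F := K)) M archPk archSub Ψ act Mmod region n lat sig split qData
        (exists_realising_qIdeles_pilotDataOfK D).choose (exists_realising_thetaIdeles_pilotDataOfK D).choose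
        (exists_realising_qIdeles_pilotDataOfK D).choose_spec.1 (exists_realising_qIdeles_pilotDataOfK D).choose_spec.2.1)
        (fun _ => Cor312.Setting.qRegion
        (settingPrVolSharp (pilotDataOfK D K) (logvAnalytic_analyticLogv (F := K)) M archPk archSub Ψ act Mmod region n lat sig split qData
        (exists_realising_qIdeles_pilotDataOfK D).choose (exists_realising_thetaIdeles_pilotDataOfK D).choose
        (exists_realising_qIdeles_pilotDataOfK D).choose_spec.1 (exists_realising_qIdeles_pilotDataOfK D).choose_spec.2.1)) qK := by
  classical
  have hL := GenuineK.licence_chosen_of_tame_shallow D M archPk archSub Ψ act Mmod region n lat sig split qData htame hshallow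
  have htqle : ∀ pp x, ‖(exists_realising_qIdeles_pilotDataOfK D).choose pp x‖ ≤ 1 := fun pp x =>
    norm_qIdele_le_one_of_realises (pilotDataOfK D K) (exists_realising_qIdeles_pilotDataOfK D).choose
      (exists_realising_qIdeles_pilotDataOfK D).choose_spec.1 (exists_realising_qIdeles_pilotDataOfK D).choose_spec.2.2 pp x
  obtain ⟨ρ, qK', hq, hh⟩ := (exists_qPinned_and_hull_settingPrVolSharp_iff_licence (pilotDataOfK D K) (logvAnalytic_analyticLogv (F := K))
    M archPk archSub Ψ act Mmod region n lat sig split qData (exists_realising_qIdeles_pilotDataOfK D).choose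
    (exists_realising_thetaIdeles_pilotDataOfK D).choose (exists_realising_qIdeles_pilotDataOfK D).choose_spec.1
    (exists_realising_qIdeles_pilotDataOfK D).choose_spec.2.1
    (col := fun m => Column.ofDivisors (logShellsDH (pilotDataOfK D K) (analyticLogv K)) M (frobAdm m) (frobLogvol m) (frobΨ m) (frobMmod m)
      (unitImage m) (ballImage m) (thetaDiv m)) htqle).mpr hL
  intro j vQ
  exact (Conditional.Antecedent.exists_qPinned_and_hull_iff _ _).mp ⟨ρ, qK', hq, hh⟩ j vQ

/-- **THE TYPED STATEMENT OF [IUTchIII] Cor. 3.12 HOLDS AT THIS GENUINE SHARP SETTING** (`Cor312.Setting.Statement` of abc-iut-c312-2, at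
abc-iut-c312-7's print-normalised `settingPrVolSharp` over the GENUINE `K`-level Dupuy–Hilado datum with the chosen realising ideles): the licence
(above) and the bridge hypotheses — every field a theorem for this setting (abc-iut-w5-d068 `bridgeHyps_settingPrVolSharp_of_ideles`, the idele side
conditions being those of the chosen realising ideles) — give the Statement by abc-iut-c312-1's `statement_of_licence`. It holds by (Ind1)-INFLATION at
shallow tame packets, NOT by the disputed inference; nothing about print is asserted. [cite: Mochizuki2012, IUTchIII Cor. 3.12 p. 173–174]
[cite: DupuyHilado2025, §3.9, §4.9] [claim: Mochizuki2012, status: disputed] -/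
theorem GenuineK.statement_chosen_of_tame_shallow
    (htame : ∀ (pp : Nat.Primes) (x : (thetaIndex (pilotDataOfK D K)).Fibre (.inr pp)),
      haveI : Fact (pp : ℕ).Prime := ⟨pp.2⟩
      (∃ w : (thetaIndex (pilotDataOfK D K)).Fibre (.inr pp), placeOf (pilotDataOfK D K) pp.1 w ∈ (pilotDataOfK D K).S) →
        2 < (pp : ℕ) ∧ (placeOf (pilotDataOfK D K) pp.1 x).asIdeal.ramificationIdx ℤ ≤ (pp : ℕ) - 2)
    (hshallow : ∀ (pp : Nat.Primes) (w : (thetaIndex (pilotDataOfK D K)).Fibre (.inr pp)),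
      haveI : Fact (pp : ℕ).Prime := ⟨pp.2⟩
      placeOf (pilotDataOfK D K) pp.1 w ∈ (pilotDataOfK D K).S →
        (finBelow F K (placeOf (pilotDataOfK D K) pp.1 w)).asIdeal.ramificationIdx' (placeOf (pilotDataOfK D K) pp.1 w).asIdeal *
            qParamOrd E (finBelow F K (placeOf (pilotDataOfK D K) pp.1 w)) ≤
          2 * (placeOf (pilotDataOfK D K) pp.1 w).asIdeal.ramificationIdx ℤ) :
    (settingPrVolSharp (pilotDataOfK D K) (logvAnalytic_analyticLogv (F := K)) M archPk archSub Ψ act Mmod region n lat sig split qData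
        (exists_realising_qIdeles_pilotDataOfK D).choose (exists_realising_thetaIdeles_pilotDataOfK D).choose
        (exists_realising_qIdeles_pilotDataOfK D).choose_spec.1 (exists_realising_qIdeles_pilotDataOfK D).choose_spec.2.1).Statement :=
  Thm311ToCor312.statement_of_licence
    (bridgeHyps_settingPrVolSharp_of_ideles (pilotDataOfK D K) (logvAnalytic_analyticLogv (F := K)) M archPk archSub Ψ act Mmod region n
      lat sig split qData (tq := (exists_realising_qIdeles_pilotDataOfK D).choose) (t := (exists_realising_thetaIdeles_pilotDataOfK D).choose)
      (exists_realising_thetaIdeles_pilotDataOfK D).choose_spec.1 (exists_realising_thetaIdeles_pilotDataOfK D).choose_spec.2.1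
      (exists_realising_qIdeles_pilotDataOfK D).choose_spec.1 (exists_realising_qIdeles_pilotDataOfK D).choose_spec.2.1)
    (GenuineK.licence_chosen_of_tame_shallow D M archPk archSub Ψ act Mmod region n lat sig split qData htame hshallow)

end PerDatum

end Summit.ABC.IUTFork.Conditional

end
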